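import Mathlib.AlgebraicGeometry.AlgClosed.Basic
import Mathlib.Analysis.Complex.Polynomial.Basic
import Literature.AlgebraicGeometry.Motives.Jacobian
import Literature.AlgebraicGeometry.Motives.AbelianVarietyComplexPoints
import Literature.AlgebraicTopology.SingularHomology.TorusBettiOne
import Literature.AlgebraicTopology.SingularHomology.CompactManifoldFiniteness
import HarnessLib

/-!
# `dim J = ½ b₁(C(ℂ))`: reduction to `H¹` of the Jacobian and to the torus structure of `A(ℂ)`

Proof file of the named fact
`Literature.AlgebraicGeometry.Motives.two_mul_dim_eq_finrank_bettiCohomology` (`Motives/Jacobian`):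
for a smooth projective curve `C/ℂ` and any Jacobian `𝒥 : Jacobian C`,
`2 · dim J = dim_ℚ H¹(C(ℂ); ℚ)` (Milne, *Jacobian Varieties*, Prop. 2.1 `dim J = g` with Thm. 2.5
`J(ℂ) = Γ(C(ℂ), Ω¹)^∨ / H₁(C(ℂ), ℤ)`; Lange, *Abelian Varieties over the Complex Numbers*, §4.1.1).
Both sides live on REAL carriers: the Krull dimension of the abstract abelian variety `𝒥.J`
(characterised only by the universal property of Milne Prop. 6.4) and genuine singular cohomology
of the complex points `C(ℂ)` with the analytic topology. (The sibling `JacobianProofs.lean`,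
`JacobianBasePoint.lean` belong to the seat of `isIso_bettiCohomology_map_abelJacobi`; this file is
kept separate so that whole-file resubmissions do not collide.)

The printed argument (Lange §4.1.1 and proof of Lemma 4.4.1; Milne Thm. 2.5; Mumford §1) has
four inputs:

* **(P)** a complex point `P ∈ C(ℂ)` — PROVED here, `nonempty_algPoints_of_isSmoothProjective`
  (over any algebraically closed field: a smooth projective variety is irreducible, hence
  non-empty, its closed points are dense — Mathlib `LocallyOfFiniteType.jacobsonSpace` — and
  rational — Hilbert's Nullstellensatz, Mathlib `pointOfClosedPoint`);
* **(X)** `(f^P)^* : H¹(J(ℂ); ℚ) ≅ H¹(C(ℂ); ℚ)` ("`α_c^*` is the transposed map of the isomorphism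
  `α_{c*} : H₁(C, ℤ) → H₁(J, ℤ)`", Lange, proof of Lemma 4.4.1; Milne Thm. 2.5) — the named fact
  `isIso_bettiCohomology_map_abelJacobi` of `Motives/Jacobian`, NOT proved in the tree (it is the
  theorem of Abel–Jacobi), taken as a hypothesis;
* **(U)** `A(ℂ) ≅ V/U ≅ (ℝ/ℤ)^{2 dim A}` — the complex points of a complex abelian variety of
  dimension `g` form a complex torus, in particular are HOMEOMORPHIC to the real torus
  `(ℝ/ℤ)^{2g}` (Mumford, *Abelian Varieties*, §1 (1)–(3): `A(ℂ)` is a compact connected complex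
  Lie group of dimension `g`, hence `V/U` with `U` a lattice in `V = ℂ^g`) — NOT in the tree in
  any form (no Lie-group structure / exponential map / uniformisation of `A(ℂ)`), and not vendored
  here either (D-0026: a discharge seat mints no new named fact); it enters as an explicit
  hypothesis `Nonempty (ComplexPoints A.X ≃ₜ (Fin (2 * A.dim) → AddCircle 1))`;
* **(B)** `b₁((ℝ/ℤ)^ι; ℚ) = |ι|` (Mumford §1 (4): `H¹(X, ℤ) ≅ Hom(U, ℤ)`; Hatcher §3.3 p. 231) —
  PROVED in the tree, `Literature.AlgebraicTopology.SingularHomology.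
  finrank_singularCohomology_one_of_homeomorph_realTorus` (`…/TorusBettiOne`, via Hurewicz and
  `π₁((ℝ/ℤ)^ι) ≅ ℤ^ι`).

What is PROVED here: (P); `b₁(A(ℂ)) = 2 dim A` from (U) and (B)
(`two_mul_dim_eq_finrank_bettiCohomology_abelianVariety_of_homeomorph`), and likewise from either
of the two weaker forms of (U) that Mumford §1 (3) prints — `π₁(A(ℂ)) ≅ U ≅ ℤ^{2g}`
(`…_of_fundamentalGroup`, through the tree's PROVED Hurewicz theorem, `A(ℂ)` being path connected
by `Motives/AbelianVarietyComplexPoints`) or `H₁(A(ℂ), ℤ) ≅ ℤ^{2g}` (`…_of_H1`, through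
`finrank_singularHomology_rat_eq_int` and universal coefficients over `ℚ`); the step
`dim_ℚ H¹(J(ℂ); ℚ) = dim_ℚ H¹(C(ℂ); ℚ)` from (X) (`finrank_bettiCohomology_jacobian_eq`); and the
glue `(X) ∧ (U) → two_mul_dim_eq_finrank_bettiCohomology`
(`two_mul_dim_eq_finrank_bettiCohomology_of_homeomorph`, `…_of_fundamentalGroup`, `…_of_H1`; the
form with `b₁(A(ℂ)) = 2 dim A` itself as hypothesis is `two_mul_dim_eq_finrank_bettiCohomology_of`).
The fact is therefore NOT discharged by this file; its remaining content is exactly (X) and (U)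
(in any of the three forms).

## References

* J. S. Milne, *Jacobian Varieties*, Ch. VII of Cornell–Silverman, *Arithmetic Geometry* (1986):
  Prop. 2.1, Thm. 2.5 (pp. 168, 170–171). [Milne1986JacobianVarieties]
* H. Lange, *Abelian Varieties over the Complex Numbers* (2023): §4.1.1, Lemma 4.4.1.
  [Lange2023AbelianVarietiesC]
* D. Mumford, *Abelian Varieties* (1970), §1 (1)–(4). [MumfordAV1970]
* A. Hatcher, *Algebraic Topology* (2002), §3.3 p. 231. [HatcherAT2002]
-/

universe u

open CategoryTheory AlgebraicGeometry

noncomputable section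

namespace Literature.AlgebraicGeometry.Motives

/-- **A smooth projective variety over an algebraically closed field has a rational point.**
`X` is irreducible (geometrically irreducible over the point `Spec k`), hence non-empty; being
locally of finite type over `k` it is a Jacobson space, so it has a closed point (Mathlib
`LocallyOfFiniteType.jacobsonSpace`, `nonempty_inter_closedPoints`), and a closed point of a
scheme locally of finite type over an algebraically closed field is `k`-rational (Hilbert's
Nullstellensatz; Mathlib `pointOfClosedPoint`). This is input (P) of the module docstring: Milne
§2 and §6 assume "a `k`-rational point `P` on `C`", automatic over `k = k̄`. [folklore] -/
theorem nonempty_algPoints_of_isSmoothProjective {k : Type u} [Field k] [IsAlgClosed k] {n : ℕ}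
    {X : SchemeOver k} (hX : IsSmoothProjective n X) : Nonempty (AlgPoints X k) := by
  haveI := hX.smoothOfRelativeDimension
  haveI : Smooth X.hom := SmoothOfRelativeDimension.smooth n X.hom
  haveI : JacobsonSpace X.left := LocallyOfFiniteType.jacobsonSpace X.hom
  haveI := hX.geometricallyIrreducible
  haveI : IrreducibleSpace X.left :=
    GeometricallyIrreducible.irreducibleSpace_of_subsingleton X.hom
  obtain ⟨x, -, hx⟩ := nonempty_inter_closedPoints (X := X.left) Set.univ_nonempty
    isClosed_univ.isLocallyClosed
  exact ⟨AlgPoints.mk (pointOfClosedPoint X.hom x hx)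
    (by rw [pointOfClosedPoint_comp, Algebra.algebraMap_self, CommRingCat.ofHom_id, Spec.map_id])⟩

/-- **`b₁(A(ℂ)) = 2 · dim A` for a complex abelian variety whose complex points are homeomorphic
to the torus `(ℝ/ℤ)^{2 dim A}`** (Mumford §1: (1)–(3) `A(ℂ) = V/U` is a complex torus of
dimension `g = dim A`, i.e. `(ℝ/ℤ)^{2g}` as a real Lie group — this is the hypothesis `e`, not
available in the tree; (4) `H¹(A(ℂ), ℤ) ≅ Hom(U, ℤ) ≅ ℤ^{2g}` — here rationally, from the tree's
PROVED `b₁((ℝ/ℤ)^ι; ℚ) = |ι|`, `finrank_singularCohomology_one_of_homeomorph_realTorus`).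
[cite: MumfordAV1970, §1 (1)–(4)] [cite: HatcherAT2002, §3.3 p. 231] -/
theorem two_mul_dim_eq_finrank_bettiCohomology_abelianVariety_of_homeomorph (A : AbelianVariety ℂ)
    (e : ComplexPoints A.X ≃ₜ (Fin (2 * A.dim) → AddCircle (1 : ℝ))) :
    2 * A.dim = Module.finrank ℚ (bettiCohomology A.X 1) := by
  rw [bettiCohomology,
    Literature.AlgebraicTopology.SingularHomology.finrank_singularCohomology_one_of_homeomorph_realTorus
      (Fin (2 * A.dim)) e, Fintype.card_fin]

/-- **`Hₖ(A(ℂ); ℤ)` is finitely generated** for a complex abelian variety `A`: `A(ℂ)` is a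
compact Hausdorff topological `2 dim A`-manifold (algebraic charts, `IsSmoothProjective.chartedSpace`
with the tree's PROVED `AbelianVariety.isSmoothProjective_holds`; compactness and separation from
`Motives/AbelianVarietyComplexPoints`), and closed manifolds have finitely generated homology
(Hatcher, App. A, Cor. A.8–A.9, the tree's PROVED `finite_singularHomology_of_compactSpace_holds`).
In Mumford's terms, `H₁(X, ℤ) ≅ U` is a lattice (§1 (3)); only its rank `2 dim A` is missing here.
[cite: HatcherAT2002, App. A Cor. A.8 and A.9 (p. 527)] [cite: MumfordAV1970, §1 (3)] -/
theorem AbelianVariety.finite_singularHomology_complexPoints_int (A : AbelianVariety ℂ) (k : ℕ) :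
    Module.Finite ℤ
      (Literature.AlgebraicTopology.SingularHomology.singularHomology ℤ ℤ (ComplexPoints A.X) k) := by
  letI := (AbelianVariety.isSmoothProjective_holds (A := A)).chartedSpace
  exact Literature.AlgebraicTopology.SingularHomology.finite_singularHomology_of_compactSpace_holds ℤ
    (ComplexPoints A.X) (2 * A.dim) k

/-- **`b₁(A(ℂ)) = 2 · dim A` from `H₁(A(ℂ), ℤ) ≅ ℤ^{2 dim A}`** (Mumford §1 (3): for the
complex torus `X = V/U`, `H₁(X, ℤ) ≅ U`, a lattice of rank `2g` — this is the hypothesis `e`, not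
available in the tree; then (4) rationally: `dim_ℚ H¹(A(ℂ); ℚ) = b₁(A(ℂ); ℚ) = rank H₁(A(ℂ); ℤ)`
by universal coefficients over the field `ℚ` and Hatcher Cor. 3A.6 (a), the tree's PROVED
`finrank_singularCohomology_eq_bettiNumber_of_field` and `finrank_singularHomology_rat_eq_int`).
[cite: MumfordAV1970, §1 (3)–(4)] [cite: HatcherAT2002, §3.A Cor. 3A.6 (a) (p. 266)] -/
theorem two_mul_dim_eq_finrank_bettiCohomology_abelianVariety_of_H1 (A : AbelianVariety ℂ)
    (e : (Fin (2 * A.dim) → ℤ) ≃ₗ[ℤ]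
      Literature.AlgebraicTopology.SingularHomology.singularHomology ℤ ℤ (ComplexPoints A.X) 1) :
    2 * A.dim = Module.finrank ℚ (bettiCohomology A.X 1) := by
  haveI : Module.Free ℤ
      (Literature.AlgebraicTopology.SingularHomology.singularHomology ℤ ℤ (ComplexPoints A.X) 1) :=
    Module.Free.of_equiv e
  rw [bettiCohomology,
    Literature.AlgebraicTopology.SingularHomology.finrank_singularCohomology_eq_bettiNumber_of_field,
    Literature.AlgebraicTopology.SingularHomology.bettiNumber,
    Literature.AlgebraicTopology.SingularHomology.finrank_singularHomology_rat_eq_int,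
    ← e.finrank_eq, Module.finrank_fintype_fun_eq_card, Fintype.card_fin]

/-- **`b₁(A(ℂ)) = 2 · dim A` from `π₁(A(ℂ)) ≅ ℤ^{2 dim A}`** (Mumford §1 (3): `π₁(X) ≅ U` for the
complex torus `X = V/U`, `V` being its universal cover — this is the hypothesis `e`, at any base
point `a`, not available in the tree; then `H₁(A(ℂ), ℤ) ≅ π₁ᵃᵇ = π₁ ≅ ℤ^{2g}` by the Hurewicz
theorem, Hatcher Thm. 2A.1, PROVED in the tree as `singularHomology.hurewicz_one_holds` — `A(ℂ)`
is path connected, `Motives/AbelianVarietyComplexPoints` — and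
`two_mul_dim_eq_finrank_bettiCohomology_abelianVariety_of_H1`).
[cite: MumfordAV1970, §1 (3)–(4)] [cite: HatcherAT2002, Thm. 2A.1 (p. 166)] -/
theorem two_mul_dim_eq_finrank_bettiCohomology_abelianVariety_of_fundamentalGroup
    (A : AbelianVariety ℂ) (a : ComplexPoints A.X)
    (e : FundamentalGroup (ComplexPoints A.X) a ≃* Multiplicative (Fin (2 * A.dim) → ℤ)) :
    2 * A.dim = Module.finrank ℚ (bettiCohomology A.X 1) := by
  obtain ⟨eH⟩ :=
    Literature.AlgebraicTopology.SingularHomology.singularHomology.nonempty_abelianization_mulEquiv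
      Literature.AlgebraicTopology.SingularHomology.singularHomology.hurewicz_one_holds.{0} a
  exact two_mul_dim_eq_finrank_bettiCohomology_abelianVariety_of_H1 A
    (AddEquiv.toMultiplicative.symm
      ((Abelianization.equivOfComm.trans e.symm.abelianizationCongr).trans eH)).toIntLinearEquiv

/-- **`dim_ℚ H¹(J(ℂ); ℚ) = dim_ℚ H¹(C(ℂ); ℚ)`** for a Jacobian `𝒥` of a smooth projective curve
`C/ℂ`, from input (X) = the named fact `isIso_bettiCohomology_map_abelJacobi` (taken as the
hypothesis `h`): choose a complex point `P ∈ C(ℂ)` (`nonempty_algPoints_of_isSmoothProjective`)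
and take dimensions in the isomorphism `(f^P)^* : H¹(J(ℂ); ℚ) ≅ H¹(C(ℂ); ℚ)` (Lange, proof of
Lemma 4.4.1: "`α_c^*` … is the transposed map of the isomorphism `α_{c*} : H₁(C, ℤ) → H₁(J, ℤ)`";
Milne Thm. 2.5). [cite: Lange2023AbelianVarietiesC, §4.1.1 and Lemma 4.4.1 (proof)] [cite: Milne1986JacobianVarieties, §2 Thm. 2.5] -/
theorem finrank_bettiCohomology_jacobian_eq (h : isIso_bettiCohomology_map_abelJacobi)
    {C : SchemeOver ℂ} (hC : IsSmoothProjective 1 C) (𝒥 : Jacobian C) :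
    Module.finrank ℚ (bettiCohomology 𝒥.J.X 1) = Module.finrank ℚ (bettiCohomology C 1) := by
  obtain ⟨P⟩ := nonempty_algPoints_of_isSmoothProjective hC
  haveI := h C hC 𝒥 P
  exact (asIso (bettiCohomology.map (𝒥.abelJacobi P) 1)).toLinearEquiv.finrank_eq

/-- **The glue of Lange §4.1.1 / Milne Thm. 2.5 for `dim J = ½ b₁(C)`.** The named fact
`two_mul_dim_eq_finrank_bettiCohomology` follows from
(X) `isIso_bettiCohomology_map_abelJacobi` (`H¹(J(ℂ)) ≅ H¹(C(ℂ))` along `f^P`) and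
(Y) `b₁(A(ℂ)) = 2 · dim A` for every complex abelian variety `A` (Mumford §1 (4):
`H¹(X, ℤ) ≅ ℤ^{2g}` for the complex torus `X = V/U`; Lange §1.1), both taken as hypotheses:
`2 · dim J = dim_ℚ H¹(J(ℂ); ℚ) = dim_ℚ H¹(C(ℂ); ℚ)`. Neither (X) nor (Y) is proved in the tree;
this theorem records that they are exactly what the fact still needs (it does not discharge it).
[cite: Lange2023AbelianVarietiesC, §4.1.1] [cite: Milne1986JacobianVarieties, §2 Prop. 2.1 and Thm. 2.5] [cite: MumfordAV1970, §1 (4)] -/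
theorem two_mul_dim_eq_finrank_bettiCohomology_of (hX : isIso_bettiCohomology_map_abelJacobi)
    (hY : ∀ A : AbelianVariety ℂ, 2 * A.dim = Module.finrank ℚ (bettiCohomology A.X 1)) :
    two_mul_dim_eq_finrank_bettiCohomology := by
  intro C hC 𝒥
  rw [hY 𝒥.J, finrank_bettiCohomology_jacobian_eq hX hC 𝒥]

/-- **`dim J = ½ b₁(C)` from Abel–Jacobi (X) and the torus structure of `A(ℂ)` (U).** The named
fact `two_mul_dim_eq_finrank_bettiCohomology` follows from
(X) `isIso_bettiCohomology_map_abelJacobi` (`(f^P)^* : H¹(J(ℂ); ℚ) ≅ H¹(C(ℂ); ℚ)`, Lange §4.1.1 /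
Lemma 4.4.1, Milne Thm. 2.5) and (U) "the complex points of a complex abelian variety `A` are
homeomorphic to the torus `(ℝ/ℤ)^{2 dim A}`" (Mumford §1 (1)–(3): `A(ℂ) = V/U`), both taken as
hypotheses; the Betti number of the torus (Mumford §1 (4)) is the tree's theorem
`finrank_singularCohomology_one_of_homeomorph_realTorus`. With (P) proved above, (X) and (U) are
exactly what the fact still needs. [cite: Milne1986JacobianVarieties, §2 Prop. 2.1 and Thm. 2.5] [cite: Lange2023AbelianVarietiesC, §4.1.1] [cite: MumfordAV1970, §1 (1)–(4)] -/
theorem two_mul_dim_eq_finrank_bettiCohomology_of_homeomorph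
    (hX : isIso_bettiCohomology_map_abelJacobi)
    (hU : ∀ A : AbelianVariety ℂ,
      Nonempty (ComplexPoints A.X ≃ₜ (Fin (2 * A.dim) → AddCircle (1 : ℝ)))) :
    two_mul_dim_eq_finrank_bettiCohomology :=
  two_mul_dim_eq_finrank_bettiCohomology_of hX fun A ↦
    let ⟨e⟩ := hU A
    two_mul_dim_eq_finrank_bettiCohomology_abelianVariety_of_homeomorph A e

/-- **`dim J = ½ b₁(C)` from Abel–Jacobi (X) and `π₁(A(ℂ)) ≅ ℤ^{2 dim A}` (Mumford §1 (3)).**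
Variant of `two_mul_dim_eq_finrank_bettiCohomology_of_homeomorph` with the torus hypothesis in
the weaker printed form "`π₁(X) ≅ U`, a lattice of rank `2g`" at some base point of each `A(ℂ)`.
[cite: Milne1986JacobianVarieties, §2 Prop. 2.1 and Thm. 2.5] [cite: Lange2023AbelianVarietiesC, §4.1.1] [cite: MumfordAV1970, §1 (3)] -/
theorem two_mul_dim_eq_finrank_bettiCohomology_of_fundamentalGroup
    (hX : isIso_bettiCohomology_map_abelJacobi)
    (hU : ∀ A : AbelianVariety ℂ, ∃ a : ComplexPoints A.X,
      Nonempty (FundamentalGroup (ComplexPoints A.X) a ≃* Multiplicative (Fin (2 * A.dim) → ℤ))) :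
    two_mul_dim_eq_finrank_bettiCohomology :=
  two_mul_dim_eq_finrank_bettiCohomology_of hX fun A ↦
    let ⟨a, ⟨e⟩⟩ := hU A
    two_mul_dim_eq_finrank_bettiCohomology_abelianVariety_of_fundamentalGroup A a e

/-- **`dim J = ½ b₁(C)` from Abel–Jacobi (X) and `H₁(A(ℂ), ℤ) ≅ ℤ^{2 dim A}` (Mumford §1 (3)).**
Variant of `two_mul_dim_eq_finrank_bettiCohomology_of_homeomorph` with the torus hypothesis in
the weaker printed form "`H₁(X, ℤ) ≅ U`" (free of rank `2g`).
[cite: Milne1986JacobianVarieties, §2 Prop. 2.1 and Thm. 2.5] [cite: Lange2023AbelianVarietiesC, §4.1.1] [cite: MumfordAV1970, §1 (3)] -/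
theorem two_mul_dim_eq_finrank_bettiCohomology_of_H1
    (hX : isIso_bettiCohomology_map_abelJacobi)
    (hU : ∀ A : AbelianVariety ℂ, Nonempty ((Fin (2 * A.dim) → ℤ) ≃ₗ[ℤ]
      Literature.AlgebraicTopology.SingularHomology.singularHomology ℤ ℤ (ComplexPoints A.X) 1)) :
    two_mul_dim_eq_finrank_bettiCohomology :=
  two_mul_dim_eq_finrank_bettiCohomology_of hX fun A ↦
    let ⟨e⟩ := hU A
    two_mul_dim_eq_finrank_bettiCohomology_abelianVariety_of_H1 A e

end Literature.AlgebraicGeometry.Motives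

end
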